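import Literature.NumberTheory.LFunctions.FordLargeLambdaCheck
import Literature.NumberTheory.LFunctions.FordLargeLambdaRows1
import Literature.NumberTheory.LFunctions.FordLargeLambdaRows2
import Literature.NumberTheory.LFunctions.FordLargeLambdaRows3
import Literature.NumberTheory.LFunctions.FordLargeLambdaRows4
import Literature.NumberTheory.LFunctions.FordLargeLambdaRows5
import Literature.NumberTheory.LFunctions.FordLargeLambdaRows6
import Literature.NumberTheory.LFunctions.FordLargeLambdaRows7
import Literature.NumberTheory.LFunctions.FordLargeLambdaRows8
import Literature.NumberTheory.LFunctions.FordLargeLambdaRows9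
import Literature.NumberTheory.LFunctions.FordLargeLambdaRows10
import Literature.NumberTheory.LFunctions.FordLargeLambdaRows11
import Literature.NumberTheory.LFunctions.FordLargeLambdaRows12
import Literature.NumberTheory.LFunctions.FordLargeLambdaRows13
import Literature.NumberTheory.LFunctions.FordLargeLambdaRows14
import Literature.NumberTheory.LFunctions.FordLargeLambdaRows15
import Literature.NumberTheory.LFunctions.FordLargeLambdaRows16
import Literature.NumberTheory.LFunctions.FordLargeLambdaRows17
import Literature.NumberTheory.LFunctions.FordLargeLambdaRows18
import Literature.NumberTheory.LFunctions.FordLargeLambdaRows19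
import Literature.NumberTheory.LFunctions.FordLargeLambdaRows20
import Literature.NumberTheory.LFunctions.FordLargeLambdaRows21
import Literature.NumberTheory.LFunctions.FordLargeLambdaRows22
import Literature.NumberTheory.LFunctions.FordLargeLambdaRows23
import Literature.NumberTheory.LFunctions.FordLargeLambdaRows24
import Literature.NumberTheory.LFunctions.FordLargeLambdaRows25
import Literature.NumberTheory.LFunctions.FordLargeLambdaRows26
import Literature.NumberTheory.LFunctions.FordLargeLambdaRows27
import Literature.NumberTheory.LFunctions.FordLargeLambdaRows28
import Literature.NumberTheory.LFunctions.FordLargeLambdaRows29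
import Literature.NumberTheory.LFunctions.FordLargeLambdaRows30
import Literature.NumberTheory.LFunctions.FordLargeLambdaRows31
import HarnessLib

/-!
# Ford's Theorem 2 for `87 ≤ λ ≤ 2025` from Theorems 3–4 (assembly of the certified rows)

Topic `Literature/NumberTheory/LFunctions`. Everything here is PROVED (no named fact, no `def`
except the concatenated row list and the coverage checker).

K. Ford, Proc. LMS 85 (2002), Theorem 2 (`S(N,t) ≤ 9.463 N^{1−1/(133.66λ²)}`) in the range
`87 ≤ λ ≤ 2025`, deduced from Theorem 3 (the three rows of (1.7), hypotheses `hT3a–c`) and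
Theorem 4 (hypothesis `hT4`, verbatim) of the source: the certified rows of
`FordLargeLambdaRows*.lean` cover `[87, 2025]` by consecutive `λ`-intervals
(`FordVK.rowsAll_chain`), each row passes `FordVK.Sec5Row.check` (kernel computations), and
`FordVK.Sec5Row.sound` (`FordLargeLambdaCheck.lean`) turns a passed row into Theorem 2 on its
interval in the nontrivial range `log N ≥ 300λ²`; the trivial range is
`FordVK.expSum_bound_trivial_range` and `N = 1` is trivial.

* `FordVK.expSum_bound_lambda_87_2025` — **Theorem 2 of the source for `N^{87} ≤ t ≤ N^{2025}`**
  (constant `9.463`, exponent `1 − (log N)²/(133.66 (log t)²)`), from `hT3a–c`, `hT4`.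

## References
* K. Ford, Proc. London Math. Soc. (3) 85 (2002), 565–633; arXiv:1910.08209: Theorem 2, §5,
  Lemmas 5.2–5.3. [Ford2002]
-/

open Finset Real

namespace Literature.NumberTheory.LFunctions
namespace FordVK

/-- Consecutive coverage of `[lo, hi]` (numerators at denominator `10¹⁰`) by the intervals of a
row list. [folklore] -/
def Sec5Row.chainOK : ℕ → ℕ → List Sec5Row → Bool
  | a, b, [] => decide (a = b)
  | a, b, R :: rest => decide (R.lamloN = a ∧ R.lamD = 10 ^ 10 ∧ a ≤ R.lamhiN) && Sec5Row.chainOK R.lamhiN b rest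

/-- A point strictly beyond `lo` and below `hi` lies in the interval of some row. [folklore] -/
theorem Sec5Row.exists_mem_of_chainOK_lt : ∀ (a b : ℕ) (l : List Sec5Row), Sec5Row.chainOK a b l = true →
    ∀ x : ℝ, (a : ℝ) / 10 ^ 10 < x → x ≤ (b : ℝ) / 10 ^ 10 →
      ∃ R ∈ l, (R.lamloN : ℝ) / R.lamD ≤ x ∧ x ≤ (R.lamhiN : ℝ) / R.lamD
  | a, b, [], h, x, hx1, hx2 => by
    simp only [chainOK, decide_eq_true_eq] at h
    subst h
    exact absurd hx2 (not_le.2 hx1)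
  | a, b, R :: rest, h, x, hx1, hx2 => by
    simp only [chainOK, Bool.and_eq_true, decide_eq_true_eq] at h
    obtain ⟨⟨hlo, hD, _⟩, hrest⟩ := h
    rcases le_or_gt x ((R.lamhiN : ℝ) / 10 ^ 10) with hx | hx
    · refine ⟨R, by simp, ?_, ?_⟩
      · rw [hD, hlo]; norm_num at hx1 ⊢; exact hx1.le
      · rw [hD]; norm_num at hx ⊢; exact hx
    · obtain ⟨R', hR', h1, h2⟩ := Sec5Row.exists_mem_of_chainOK_lt R.lamhiN b rest hrest x hx hx2
      exact ⟨R', by simp [hR'], h1, h2⟩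

/-- A covered point lies in the interval of some row (nonempty chain). [folklore] -/
theorem Sec5Row.exists_mem_of_chainOK {a b : ℕ} {R : Sec5Row} {rest : List Sec5Row}
    (h : Sec5Row.chainOK a b (R :: rest) = true) {x : ℝ} (hx1 : (a : ℝ) / 10 ^ 10 ≤ x)
    (hx2 : x ≤ (b : ℝ) / 10 ^ 10) :
    ∃ R' ∈ R :: rest, (R'.lamloN : ℝ) / R'.lamD ≤ x ∧ x ≤ (R'.lamhiN : ℝ) / R'.lamD := by
  simp only [chainOK, Bool.and_eq_true, decide_eq_true_eq] at h
  obtain ⟨⟨hlo, hD, _⟩, hrest⟩ := h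
  rcases le_or_gt x ((R.lamhiN : ℝ) / 10 ^ 10) with hx | hx
  · refine ⟨R, by simp, ?_, ?_⟩
    · rw [hD, hlo]; norm_num at hx1 ⊢; exact hx1
    · rw [hD]; norm_num at hx ⊢; exact hx
  · obtain ⟨R', hR', h1, h2⟩ := Sec5Row.exists_mem_of_chainOK_lt R.lamhiN b rest hrest x hx hx2
    exact ⟨R', by simp [hR'], h1, h2⟩

/-- All certified rows, `λ ∈ [87, 2025]`. [cite: Ford2002, proof of Lemma 5.3 (Program 2)] -/
def rowsAll : List Sec5Row :=
  rows1 ++ rows2 ++ rows3 ++ rows4 ++ rows5 ++ rows6 ++ rows7 ++ rows8 ++ rows9 ++ rows10 ++ rows11 ++ rows12 ++ rows13 ++ rows14 ++ rows15 ++ rows16 ++ rows17 ++ rows18 ++ rows19 ++ rows20 ++ rows21 ++ rows22 ++ rows23 ++ rows24 ++ rows25 ++ rows26 ++ rows27 ++ rows28 ++ rows29 ++ rows30 ++ rows31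

/-- Every row passes the checker (the kernel computations of the chunk files). [cite: Ford2002, proof of Lemma 5.3] -/
theorem rowsAll_check : rowsAll.all Sec5Row.check = true := by
  simp only [rowsAll, List.all_append, rows1_check, rows2_check, rows3_check, rows4_check, rows5_check, rows6_check, rows7_check, rows8_check, rows9_check, rows10_check, rows11_check, rows12_check, rows13_check, rows14_check, rows15_check, rows16_check, rows17_check, rows18_check, rows19_check, rows20_check, rows21_check, rows22_check, rows23_check, rows24_check, rows25_check, rows26_check, rows27_check, rows28_check, rows29_check, rows30_check, rows31_check, Bool.and_self]

set_option maxHeartbeats 0 in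
/-- The rows cover `[87, 2025]` consecutively. [folklore] -/
theorem rowsAll_chain : Sec5Row.chainOK (87 * 10 ^ 10) (2025 * 10 ^ 10) rowsAll = true := by
  decide +kernel

/-- `rowsAll` is nonempty. [folklore] -/
theorem rowsAll_ne_nil : rowsAll ≠ [] := by decide

/-- Coverage for nonempty chains. [folklore] -/
theorem Sec5Row.exists_mem_of_chainOK' {lo hi : ℕ} {l : List Sec5Row} (h : Sec5Row.chainOK lo hi l = true)
    (hne : l ≠ []) {x : ℝ} (hx1 : (lo : ℝ) / 10 ^ 10 ≤ x) (hx2 : x ≤ (hi : ℝ) / 10 ^ 10) :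
    ∃ R ∈ l, (R.lamloN : ℝ) / R.lamD ≤ x ∧ x ≤ (R.lamhiN : ℝ) / R.lamD := by
  cases l with
  | nil => exact absurd rfl hne
  | cons R rest => exact Sec5Row.exists_mem_of_chainOK h hx1 hx2

/-- **Ford's Theorem 2 for `N^{87} ≤ t ≤ N^{2000}`, from Theorem 3 ((1.7)) and Theorem 4 of the
source**: `‖∑_{N<n≤R} (n+u)^{-it}‖ ≤ 9.463 N^{1 − (log N)²/(133.66 (log t)²)}` for `1 ≤ N < R ≤ 2N`,
`0 < u ≤ 1`. Hypotheses `hT3a–c`: the rows `(ρ, θ)` of (1.7) (Theorem 3: for `k ≥ 129` there is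
`s ≤ ρk²` with `J_{s,k}(P) ≤ k^{θk³} P^{2s − k(k+1)/2 + 0.001k²}`); `hT4`: Theorem 4 verbatim. These are
§§3–4 of the source (explicit Vinogradov mean value theorems) and are not yet in the tree.
[cite: Ford2002, Theorem 2 (proof, §5, Lemmas 5.2–5.3)] -/
theorem expSum_bound_lambda_87_2025
    (hT3a : ∀ k : ℕ, 200 ≤ k → ∃ s₃ : ℕ, 1 ≤ s₃ ∧ (s₃ : ℝ) ≤ 3.21432 * (k : ℝ) ^ 2 ∧ ∀ P : ℕ, 1 ≤ P →
      (VMV.J k s₃ (Finset.Icc (1 : ℤ) P) : ℝ) ≤ (k : ℝ) ^ (2.3291 * (k : ℝ) ^ 3)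
        * (P : ℝ) ^ ((2 * s₃ : ℝ) - ((k * (k + 1) / 2 : ℕ) : ℝ) + 0.001 * (k : ℝ) ^ 2))
    (hT3b : ∀ k : ℕ, 150 ≤ k → k ≤ 199 → ∃ s₃ : ℕ, 1 ≤ s₃ ∧ (s₃ : ℝ) ≤ 3.21734 * (k : ℝ) ^ 2 ∧ ∀ P : ℕ, 1 ≤ P →
      (VMV.J k s₃ (Finset.Icc (1 : ℤ) P) : ℝ) ≤ (k : ℝ) ^ (2.3849 * (k : ℝ) ^ 3)
        * (P : ℝ) ^ ((2 * s₃ : ℝ) - ((k * (k + 1) / 2 : ℕ) : ℝ) + 0.001 * (k : ℝ) ^ 2))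
    (hT3c : ∀ k : ℕ, 129 ≤ k → k ≤ 149 → ∃ s₃ : ℕ, 1 ≤ s₃ ∧ (s₃ : ℝ) ≤ 3.22313 * (k : ℝ) ^ 2 ∧ ∀ P : ℕ, 1 ≤ P →
      (VMV.J k s₃ (Finset.Icc (1 : ℤ) P) : ℝ) ≤ (k : ℝ) ^ (2.4183 * (k : ℝ) ^ 3)
        * (P : ℝ) ^ ((2 * s₃ : ℝ) - ((k * (k + 1) / 2 : ℕ) : ℝ) + 0.001 * (k : ℝ) ^ 2))
    (hT4 : ∀ (k h s : ℕ) (P η D : ℝ), 60 ≤ k → (0.9 : ℝ) * k ≤ h → h + 2 ≤ k →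
      2 * (k - h + 1) ≤ s → s ≤ (h / 2) * (k - h + 1) → 10 ≤ D → Real.exp (D * (k : ℝ) ^ 2) ≤ P →
      2 / (k : ℝ) ^ 3 < η → η ≤ 1 / (2 * (k : ℝ)) →
      18 / (k : ℝ) ≤ 4 * Real.log k / (D * (k : ℝ) ^ 2 * η) →
      4 * Real.log k / (D * (k : ℝ) ^ 2 * η) ≤ 0.4 →
      (Jinc k s ((calC P (P ^ η)).map Nat.castEmbedding) h k : ℝ)
        ≤ Real.exp ((s : ℝ) ^ 2 / ((k : ℝ) - h + 1)
            + 10.5 * ((k : ℝ) - h + 1) * Real.log k ^ 2 / (D * k * η ^ 2)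
            - s * ((1 / η + h) * (1 - 1 / (h : ℝ)) ^ ((s : ℝ) / ((k : ℝ) - h + 1)) - h)
              * Real.log (1 / (10 * η)))
          * P ^ ((2 * s : ℝ) - ((k : ℝ) - h + 1) / 2 * (h + k) + ((k : ℝ) - h + 1) * ((k : ℝ) - h) / 2
            + η * (s : ℝ) ^ 2 / (2 * ((k : ℝ) - h + 1))
            + h * ((k : ℝ) - h + 1) * Real.exp (-(s : ℝ) / (h * ((k : ℝ) - h + 1)))))
    {N R₀ : ℕ} {t u : ℝ} (hN : 1 ≤ N) (hNR : N < R₀) (hR : R₀ ≤ 2 * N) (hu0 : 0 < u) (hu1 : u ≤ 1)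
    (ht1 : (N : ℝ) ^ (87 : ℕ) ≤ t) (ht2 : t ≤ (N : ℝ) ^ (2025 : ℕ)) :
    ‖∑ n ∈ Ioc N R₀, ((n : ℂ) + u) ^ (-(t * Complex.I))‖
      ≤ 9.463 * (N : ℝ) ^ (1 - Real.log N ^ 2 / (133.66 * Real.log t ^ 2)) := by
  have hS := norm_shifted_sum_le_trivial hR hu0 (t := t)
  rcases eq_or_lt_of_le hN with hN1 | hN2
  · -- `N = 1`
    subst hN1
    simp only [Nat.cast_one, Real.one_rpow, mul_one] at hS ⊢
    linarith
  -- `N ≥ 2`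
  have hN0 : (0 : ℝ) < N := by positivity
  have hN1' : (1 : ℝ) < N := by exact_mod_cast hN2
  have hL : 0 < Real.log N := Real.log_pos hN1'
  have hNpow : (1 : ℝ) < (N : ℝ) ^ (87 : ℕ) := one_lt_pow₀ hN1' (by norm_num)
  have ht1' : 1 < t := lt_of_lt_of_le hNpow ht1
  have ht0 : 0 < t := by linarith
  have hlog1 : (87 : ℝ) * Real.log N ≤ Real.log t := by
    have := Real.log_le_log (by positivity) ht1
    rwa [Real.log_pow, Nat.cast_ofNat] at this
  have hlog2 : Real.log t ≤ 2025 * Real.log N := by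
    have := Real.log_le_log ht0 ht2
    rwa [Real.log_pow, Nat.cast_ofNat] at this
  by_cases hsmall : Real.log N ^ 3 ≤ 300 * Real.log t ^ 2
  · have h := expSum_bound_trivial_range hN hR hu0 ht1' hsmall (R₀ := R₀)
    refine (h.trans ?_)
    exact mul_le_mul_of_nonneg_right (by norm_num) (by positivity)
  · push Not at hsmall
    have hbig : 300 * (Real.log t / Real.log N) ^ 2 ≤ Real.log N := by
      rw [div_pow, ← mul_div_assoc, div_le_iff₀ (by positivity)]
      nlinarith [hsmall]
    set lam := Real.log t / Real.log N with hlam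
    have hlam1 : ((87 * 10 ^ 10 : ℕ) : ℝ) / 10 ^ 10 ≤ lam := by
      rw [hlam, le_div_iff₀ hL]; push_cast; linarith
    have hlam2 : lam ≤ ((2025 * 10 ^ 10 : ℕ) : ℝ) / 10 ^ 10 := by
      rw [hlam, div_le_iff₀ hL]; push_cast; linarith
    obtain ⟨R, hRmem, h1, h2⟩ := Sec5Row.exists_mem_of_chainOK' rowsAll_chain rowsAll_ne_nil hlam1 hlam2
    have hcheck : R.check = true := List.all_eq_true.1 rowsAll_check R hRmem
    have hlo : (R.lamloN : ℝ) / R.lamD * Real.log N ≤ Real.log t := by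
      rw [hlam, le_div_iff₀ hL] at h1; exact h1
    have hhi : Real.log t ≤ (R.lamhiN : ℝ) / R.lamD * Real.log N := by
      rw [hlam, div_le_iff₀ hL] at h2; exact h2
    exact R.sound hcheck hT3a hT3b hT3c hT4 (by omega) hNR hR hu0 hu1 ht0 hlo hhi hbig

end FordVK
end Literature.NumberTheory.LFunctions
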